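import Summits.AtomisticToContinuum.HydrodynamicLimit.Theorems.CollisionIsometryCLTMacroClosureStubThermoEos
import Literature.MathematicalPhysics.KineticTheory.HardSphereEulerSymmetricForm
import Literature.MathematicalPhysics.KineticTheory.HardSphereEulerPrimitiveForm

/-!
# Stub `stub_thermo` of the line `IdeatorTwoGen1Sketch` (crux `MacroClosure`, stmt-14870) —
# part 3a: the entropy-variable field of a classical solution and its derivatives

Support file (registered sub-goal `stub_thermo_lambdaDeriv`) for the stub
`Barycentric.stub_thermo : ∃ η₃, 0 < η₃ ∧ ThermoChamber η₃`.

For a classical hs-Euler solution `(ρ, u, θ)` on `[0, T)` with packing `ρσ³ < η ≤ η₀` the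
entropy-variable field `Λ s x = Dη_σ(U s x)`, `U = stateOf ρ u θ`, is jointly smooth
(`isSmoothSpaceTimeOn_Lambda`), equals the explicit covector
`V ↦ λ⁰ V.1 + ⟪θ⁻¹u, V.2.1⟫ − θ⁻¹ V.2.2` (`fderiv_hsEntropy_apply` of part 1), and its one-sided
time derivative and its spatial partial derivatives, applied to a vector, are given by the
one-parameter derivative of that covector along the solution (`hasDerivWithinAt_entropyVar`):
`∂Λ·V = (Y(x) ∂ρ/ρ − (3/2)∂θ/θ − ⟪u,∂u⟫/θ + |u|²∂θ/(2θ²)) V.1 + ⟪∂u,V.2.1⟫/θ − ∂θ⟪u,V.2.1⟫/θ²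
 + ∂θ V.2.2/θ²`, `Y(x) = 1 + 2xF′(x) + x²F″(x)`, `x = ρσ³`.
-/

noncomputable section

open MeasureTheory Filter Set Topology InformationTheory
open scoped ENNReal ContDiff

namespace Summit.AtomisticToContinuum.HydrodynamicLimit.Theorems.MacroClosureLine

open Literature.MathematicalPhysics.KineticTheory Literature.Analysis.FluidPDE
open Literature.Analysis.FunctionSpaces

namespace Barycentric

variable {η₀ : ℝ} {F : ℝ → ℝ}

/-! ## The one-parameter derivative of the entropy variables -/

/-- **Derivative of the entropy variables along a one-parameter family** `(ρ(τ), u(τ), θ(τ))`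
(within a set): the covector `V ↦ λ⁰ V.1 + θ⁻¹⟪u, V.2.1⟫ − θ⁻¹ V.2.2` with
`λ⁰ = log ρ + F(ρσ³) + ρσ³F′(ρσ³) − (3/2) log θ − |u|²/(2θ) + 5/2`, applied to a fixed `V`. -/
theorem hasDerivWithinAt_entropyVar (hFa : AnalyticOnNhd ℝ F (Ioo (-η₀) η₀)) {σ : ℝ} (hσ : 0 < σ)
    {ρf θf : ℝ → ℝ} {uf : ℝ → V3} {ρ' θ' : ℝ} {u' : V3} {S : Set ℝ} {t : ℝ}
    (hρ : HasDerivWithinAt ρf ρ' S t) (hu : HasDerivWithinAt uf u' S t)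
    (hθ : HasDerivWithinAt θf θ' S t) (hρ0 : 0 < ρf t) (hθ0 : 0 < θf t)
    (hx : ρf t * σ ^ 3 < η₀) (V : State) :
    HasDerivWithinAt (fun τ => (Real.log (ρf τ) + F (ρf τ * σ ^ 3) +
        ρf τ * σ ^ 3 * deriv F (ρf τ * σ ^ 3) - 3 / 2 * Real.log (θf τ) -
        ‖uf τ‖ ^ 2 / (2 * θf τ) + 5 / 2) * V.1 +
        (θf τ)⁻¹ * inner ℝ (uf τ) V.2.1 - (θf τ)⁻¹ * V.2.2)
      (((1 + 2 * (ρf t * σ ^ 3) * deriv F (ρf t * σ ^ 3) +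
            (ρf t * σ ^ 3) ^ 2 * deriv (deriv F) (ρf t * σ ^ 3)) * ρ' / ρf t -
          3 / 2 * θ' / θf t - inner ℝ (uf t) u' / θf t + ‖uf t‖ ^ 2 * θ' / (2 * θf t ^ 2)) * V.1 +
        (inner ℝ u' V.2.1 / θf t - θ' * inner ℝ (uf t) V.2.1 / θf t ^ 2) +
        θ' * V.2.2 / θf t ^ 2) S t := by
  set x := ρf t * σ ^ 3 with hx_def
  have hx0 : 0 < x := by positivity
  have hxI : x ∈ Ioo (-η₀) η₀ := ⟨by linarith, hx⟩
  have hFd : HasDerivAt F (deriv F x) x := (hFa x hxI).differentiableAt.hasDerivAt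
  have hF'd : HasDerivAt (deriv F) (deriv (deriv F) x) x :=
    (hFa.deriv x hxI).differentiableAt.hasDerivAt
  have hxρ : HasDerivWithinAt (fun τ => ρf τ * σ ^ 3) (ρ' * σ ^ 3) S t := hρ.mul_const _
  have h1 : HasDerivWithinAt (fun τ => F (ρf τ * σ ^ 3)) (deriv F x * (ρ' * σ ^ 3)) S t :=
    hFd.comp_hasDerivWithinAt t hxρ
  have h2 : HasDerivWithinAt (fun τ => deriv F (ρf τ * σ ^ 3))
      (deriv (deriv F) x * (ρ' * σ ^ 3)) S t :=
    HasDerivAt.comp_hasDerivWithinAt (h₂ := deriv F) t hF'd hxρ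
  have h3 := hxρ.fun_mul h2
  have hlogρ := hρ.log hρ0.ne'
  have hlogθ := hθ.log hθ0.ne'
  have hq := hu.norm_sq.div (hθ.const_mul 2) (by positivity)
  have hlam := ((((hlogρ.add h1).add h3).sub (hlogθ.const_mul (3 / 2))).sub hq).add_const (5 / 2)
  have hA := hlam.mul_const V.1
  have hinv := hθ.fun_inv hθ0.ne'
  have hB := hinv.fun_mul (hu.inner ℝ (hasDerivWithinAt_const t S V.2.1))
  have hC := hinv.mul_const V.2.2
  have hall := (hA.add hB).sub hC
  refine (hall.congr_of_eventuallyEq (Eventually.of_forall fun τ => ?_) ?_).congr_deriv ?_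
  · simp only [Pi.add_apply, Pi.sub_apply, Pi.div_apply]
  · simp only [Pi.add_apply, Pi.sub_apply, Pi.div_apply]
  · simp only [inner_zero_right, zero_add, hx_def]
    field_simp
    ring

/-! ## The entropy-variable field of a classical solution -/

section Solution

variable {σ η T : ℝ} {ρ θ : ℝ → T3 → ℝ} {u : ℝ → T3 → V3}

/-- The state field `U = stateOf ρ u θ` of a classical solution is jointly smooth. -/
theorem isSmoothSpaceTimeOn_stateOf (hE : IsHardSphereEulerSolution σ T ρ u θ) :
    Torus.IsSmoothSpaceTimeOn (Ico 0 T) (fun s x => stateOf (ρ s x) (u s x) (θ s x)) := by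
  have h1 := hE.smooth_density
  have h2 : Torus.IsSmoothSpaceTimeOn (Ico 0 T) (fun s x => ρ s x • u s x) :=
    hE.smooth_density.smul hE.smooth_velocity
  have h3 : Torus.IsSmoothSpaceTimeOn (Ico 0 T)
      (fun s x => totalEnergyDensity (ρ s x) (u s x) (θ s x)) := by
    unfold totalEnergyDensity
    exact hE.smooth_density.mul ((((hE.smooth_velocity.norm_sq ℝ).div_const 2)).add
      (contDiffOn_const.mul hE.smooth_temperature))
  exact h1.prodMk (h2.prodMk h3)

/-- The state field takes values in the chamber `chamber σ η₀` when the packing is `< η ≤ η₀`. -/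
theorem stateOf_solution_mem (hE : IsHardSphereEulerSolution σ T ρ u θ) (hη : η ≤ η₀)
    (hpack : ∀ s ∈ Ico 0 T, ∀ x, ρ s x * σ ^ 3 < η) {s : ℝ} (hs : s ∈ Ico 0 T) (x : T3) :
    stateOf (ρ s x) (u s x) (θ s x) ∈ chamber σ η₀ :=
  stateOf_mem_chamber (u s x) (hE.density_pos s hs x) (hE.temperature_pos s hs x)
    (lt_of_lt_of_le (hpack s hs x) hη)

/-- **Clause 3a: the entropy-variable field `Λ = Dη_σ(U)` is jointly smooth on `[0, T) × 𝕋³`**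
(composition of the smooth `Dη_σ` on the open chamber with the smooth state field). -/
theorem isSmoothSpaceTimeOn_Lambda (hFa : AnalyticOnNhd ℝ F (Ioo (-η₀) η₀))
    (hF : EqOn hsExcessFreeEnergy F (Ico 0 η₀)) (hσ : 0 < σ)
    (hE : IsHardSphereEulerSolution σ T ρ u θ) (hη : η ≤ η₀)
    (hpack : ∀ s ∈ Ico 0 T, ∀ x, ρ s x * σ ^ 3 < η) :
    Torus.IsSmoothSpaceTimeOn (Ico 0 T)
      (fun s x => fderiv ℝ (hsEntropy σ) (stateOf (ρ s x) (u s x) (θ s x))) := by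
  have hD : ContDiffOn ℝ ∞ (fderiv ℝ (hsEntropy σ)) (chamber σ η₀) :=
    (contDiffOn_hsEntropy hFa hF hσ le_rfl).fderiv_of_isOpen (isOpen_chamber σ η₀) le_rfl
  refine hD.comp (isSmoothSpaceTimeOn_stateOf hE) ?_
  rintro ⟨s, y⟩ hp
  exact stateOf_solution_mem hE hη hpack (mem_prod.1 hp).1 _

/-- The time slices of `Λ` are `C¹` on the torus. -/
theorem isContDiff_Lambda_slice (hFa : AnalyticOnNhd ℝ F (Ioo (-η₀) η₀))
    (hF : EqOn hsExcessFreeEnergy F (Ico 0 η₀)) (hσ : 0 < σ)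
    (hE : IsHardSphereEulerSolution σ T ρ u θ) (hη : η ≤ η₀)
    (hpack : ∀ s ∈ Ico 0 T, ∀ x, ρ s x * σ ^ 3 < η) {s : ℝ} (hs : s ∈ Ico 0 T) :
    Torus.IsContDiff 1 (fun x => fderiv ℝ (hsEntropy σ) (stateOf (ρ s x) (u s x) (θ s x))) :=
  ((isSmoothSpaceTimeOn_Lambda hFa hF hσ hE hη hpack).isSmooth_slice hs).isContDiff (by simp)

/-- **Clause 3b: the explicit form of `Λ`** along the solution (with `f_ex` replaced by the
analytic `F` and `f_ex′` by `F′`, legitimate at packing in `(0, η₀)`). -/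
theorem Lambda_apply_eq (hFa : AnalyticOnNhd ℝ F (Ioo (-η₀) η₀))
    (hF : EqOn hsExcessFreeEnergy F (Ico 0 η₀)) (hσ : 0 < σ)
    (hE : IsHardSphereEulerSolution σ T ρ u θ) (hη : η ≤ η₀)
    (hpack : ∀ s ∈ Ico 0 T, ∀ x, ρ s x * σ ^ 3 < η) {s : ℝ} (hs : s ∈ Ico 0 T) (x : T3)
    (V : State) :
    fderiv ℝ (hsEntropy σ) (stateOf (ρ s x) (u s x) (θ s x)) V =
      (Real.log (ρ s x) + F (ρ s x * σ ^ 3) + ρ s x * σ ^ 3 * deriv F (ρ s x * σ ^ 3) -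
          3 / 2 * Real.log (θ s x) - ‖u s x‖ ^ 2 / (2 * θ s x) + 5 / 2) * V.1 +
        (θ s x)⁻¹ * inner ℝ (u s x) V.2.1 - (θ s x)⁻¹ * V.2.2 := by
  have hxI : ρ s x * σ ^ 3 ∈ Ioo 0 η₀ :=
    ⟨mul_pos (hE.density_pos s hs x) (by positivity), lt_of_lt_of_le (hpack s hs x) hη⟩
  rw [fderiv_hsEntropy_apply hFa hF (u s x) hσ (hE.density_pos s hs x) (hE.temperature_pos s hs x)
    hxI.2 V, hF (Ioo_subset_Ico_self hxI), deriv_hsExcessFreeEnergy_eq hF hxI, real_inner_smul_left]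

/-- **Time derivative of `Λ`, applied to a vector**: the one-parameter formula with the one-sided
time derivatives of `ρ, u, θ`. -/
theorem timeDerivWithin_Lambda_apply (hFa : AnalyticOnNhd ℝ F (Ioo (-η₀) η₀))
    (hF : EqOn hsExcessFreeEnergy F (Ico 0 η₀)) (hσ : 0 < σ)
    (hE : IsHardSphereEulerSolution σ T ρ u θ) (hη : η ≤ η₀)
    (hpack : ∀ s ∈ Ico 0 T, ∀ x, ρ s x * σ ^ 3 < η) {s : ℝ} (hs : s ∈ Ico 0 T) (x : T3)
    (V : State) :
    Torus.timeDerivWithin (Ico 0 T)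
        (fun s x => fderiv ℝ (hsEntropy σ) (stateOf (ρ s x) (u s x) (θ s x))) s x V =
      ((1 + 2 * (ρ s x * σ ^ 3) * deriv F (ρ s x * σ ^ 3) +
            (ρ s x * σ ^ 3) ^ 2 * deriv (deriv F) (ρ s x * σ ^ 3)) *
            Torus.timeDerivWithin (Ico 0 T) ρ s x / ρ s x -
          3 / 2 * Torus.timeDerivWithin (Ico 0 T) θ s x / θ s x -
          inner ℝ (u s x) (Torus.timeDerivWithin (Ico 0 T) u s x) / θ s x +
          ‖u s x‖ ^ 2 * Torus.timeDerivWithin (Ico 0 T) θ s x / (2 * θ s x ^ 2)) * V.1 +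
        (inner ℝ (Torus.timeDerivWithin (Ico 0 T) u s x) V.2.1 / θ s x -
          Torus.timeDerivWithin (Ico 0 T) θ s x * inner ℝ (u s x) V.2.1 / θ s x ^ 2) +
        Torus.timeDerivWithin (Ico 0 T) θ s x * V.2.2 / θ s x ^ 2 := by
  have hU : UniqueDiffOn ℝ (Ico (0 : ℝ) T) := uniqueDiffOn_Ico 0 T
  have hΛ := isSmoothSpaceTimeOn_Lambda hFa hF hσ hE hη hpack
  -- applying the vector commutes with the time derivative
  have h1 := timeDerivWithin_clm_apply (ContinuousLinearMap.apply ℝ ℝ V) hΛ hU hs x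
  simp only [ContinuousLinearMap.apply_apply] at h1
  rw [← h1]
  -- replace `Λ · V` by its explicit form on the time set
  unfold Torus.timeDerivWithin
  rw [derivWithin_congr (fun τ hτ => Lambda_apply_eq hFa hF hσ hE hη hpack hτ x V)
    (Lambda_apply_eq hFa hF hσ hE hη hpack hs x V)]
  exact (hasDerivWithinAt_entropyVar hFa hσ (hE.smooth_density.hasDerivWithinAt_slice hs x)
    (hE.smooth_velocity.hasDerivWithinAt_slice hs x)
    (hE.smooth_temperature.hasDerivWithinAt_slice hs x) (hE.density_pos s hs x)
    (hE.temperature_pos s hs x) (lt_of_lt_of_le (hpack s hs x) hη) V).derivWithin (hU s hs)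

/-- **Spatial partial derivatives of `Λ`, applied to a vector**: the one-parameter formula with
the partial derivatives of `ρ, u, θ`. -/
theorem partialDeriv_Lambda_apply (hFa : AnalyticOnNhd ℝ F (Ioo (-η₀) η₀))
    (hF : EqOn hsExcessFreeEnergy F (Ico 0 η₀)) (hσ : 0 < σ)
    (hE : IsHardSphereEulerSolution σ T ρ u θ) (hη : η ≤ η₀)
    (hpack : ∀ s ∈ Ico 0 T, ∀ x, ρ s x * σ ^ 3 < η) {s : ℝ} (hs : s ∈ Ico 0 T) (x : T3)
    (j : Fin 3) (W : State) :
    Torus.partialDeriv j (fun y => fderiv ℝ (hsEntropy σ) (stateOf (ρ s y) (u s y) (θ s y))) x W =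
      ((1 + 2 * (ρ s x * σ ^ 3) * deriv F (ρ s x * σ ^ 3) +
            (ρ s x * σ ^ 3) ^ 2 * deriv (deriv F) (ρ s x * σ ^ 3)) *
            Torus.partialDeriv j (ρ s) x / ρ s x -
          3 / 2 * Torus.partialDeriv j (θ s) x / θ s x -
          inner ℝ (u s x) (Torus.partialDeriv j (u s) x) / θ s x +
          ‖u s x‖ ^ 2 * Torus.partialDeriv j (θ s) x / (2 * θ s x ^ 2)) * W.1 +
        (inner ℝ (Torus.partialDeriv j (u s) x) W.2.1 / θ s x -
          Torus.partialDeriv j (θ s) x * inner ℝ (u s x) W.2.1 / θ s x ^ 2) +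
        Torus.partialDeriv j (θ s) x * W.2.2 / θ s x ^ 2 := by
  have hΛ1 := isContDiff_Lambda_slice hFa hF hσ hE hη hpack hs
  have h1 := partialDeriv_clm_apply_of_isContDiff (ContinuousLinearMap.apply ℝ ℝ W) hΛ1 j x
  simp only [ContinuousLinearMap.apply_apply] at h1
  rw [← h1]
  have hfun : (fun y => fderiv ℝ (hsEntropy σ) (stateOf (ρ s y) (u s y) (θ s y)) W) = fun y =>
      (Real.log (ρ s y) + F (ρ s y * σ ^ 3) + ρ s y * σ ^ 3 * deriv F (ρ s y * σ ^ 3) -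
          3 / 2 * Real.log (θ s y) - ‖u s y‖ ^ 2 / (2 * θ s y) + 5 / 2) * W.1 +
        (θ s y)⁻¹ * inner ℝ (u s y) W.2.1 - (θ s y)⁻¹ * W.2.2 :=
    funext fun y => Lambda_apply_eq hFa hF hσ hE hη hpack hs y W
  rw [hfun]
  have hρ1 : Torus.IsContDiff 1 (ρ s) := (hE.smooth_density.isSmooth_slice hs).isContDiff (by simp)
  have hu1 : Torus.IsContDiff 1 (u s) := (hE.smooth_velocity.isSmooth_slice hs).isContDiff (by simp)
  have hθ1 : Torus.IsContDiff 1 (θ s) :=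
    (hE.smooth_temperature.isSmooth_slice hs).isContDiff (by simp)
  set e : V3 := EuclideanSpace.single j (1 : ℝ) with he
  have cρ : HasDerivAt (fun τ : ℝ => ρ s (x + Torus.proj (τ • e)))
      (Torus.partialDeriv j (ρ s) x) 0 := HsEulerCalc.hasDerivAt_coordLine hρ1 x j
  have cθ : HasDerivAt (fun τ : ℝ => θ s (x + Torus.proj (τ • e)))
      (Torus.partialDeriv j (θ s) x) 0 := HsEulerCalc.hasDerivAt_coordLine hθ1 x j
  have cu : HasDerivAt (fun τ : ℝ => u s (x + Torus.proj (τ • e)))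
      (Torus.partialDeriv j (u s) x) 0 := by
    have h := Torus.hasDerivAt_comp_add_proj_smul hu1 x e 0
    simp only [zero_smul, Torus.proj_zero, add_zero] at h
    exact h
  have h := hasDerivWithinAt_entropyVar (S := univ) hFa hσ cρ.hasDerivWithinAt cu.hasDerivWithinAt
    cθ.hasDerivWithinAt (by simpa using hE.density_pos s hs x)
    (by simpa using hE.temperature_pos s hs x)
    (by simpa using lt_of_lt_of_le (hpack s hs x) hη) W
  rw [hasDerivWithinAt_univ] at h
  have h' := h.deriv
  simp only [zero_smul, Torus.proj_zero, add_zero] at h'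
  exact h'

end Solution

/-- **Registered sub-goal `stub_thermo_lambdaDeriv` of `stub_thermo`**: clauses 3a–3b of
`ThermoChamber` together with the derivative formulas of the entropy-variable field that feed the
compatibility identity of clause 3c. -/
theorem stub_thermo_lambdaDeriv : ∀ (η₀ : ℝ) (F : ℝ → ℝ), AnalyticOnNhd ℝ F (Ioo (-η₀) η₀) →
    EqOn hsExcessFreeEnergy F (Ico 0 η₀) → ∀ σ η : ℝ, 0 < σ → η ≤ η₀ →
    ∀ (T : ℝ) (ρ θ : ℝ → T3 → ℝ) (u : ℝ → T3 → V3), IsHardSphereEulerSolution σ T ρ u θ →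
    (∀ s ∈ Ico 0 T, ∀ x, ρ s x * σ ^ 3 < η) →
    Torus.IsSmoothSpaceTimeOn (Ico 0 T)
        (fun s x => fderiv ℝ (hsEntropy σ) (stateOf (ρ s x) (u s x) (θ s x))) ∧
    ∀ s ∈ Ico 0 T, ∀ (x : T3) (V : State),
      fderiv ℝ (hsEntropy σ) (stateOf (ρ s x) (u s x) (θ s x)) V =
        (Real.log (ρ s x) + F (ρ s x * σ ^ 3) + ρ s x * σ ^ 3 * deriv F (ρ s x * σ ^ 3) -
            3 / 2 * Real.log (θ s x) - ‖u s x‖ ^ 2 / (2 * θ s x) + 5 / 2) * V.1 +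
          (θ s x)⁻¹ * inner ℝ (u s x) V.2.1 - (θ s x)⁻¹ * V.2.2 ∧
      Torus.timeDerivWithin (Ico 0 T)
          (fun s x => fderiv ℝ (hsEntropy σ) (stateOf (ρ s x) (u s x) (θ s x))) s x V =
        ((1 + 2 * (ρ s x * σ ^ 3) * deriv F (ρ s x * σ ^ 3) +
              (ρ s x * σ ^ 3) ^ 2 * deriv (deriv F) (ρ s x * σ ^ 3)) *
              Torus.timeDerivWithin (Ico 0 T) ρ s x / ρ s x -
            3 / 2 * Torus.timeDerivWithin (Ico 0 T) θ s x / θ s x -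
            inner ℝ (u s x) (Torus.timeDerivWithin (Ico 0 T) u s x) / θ s x +
            ‖u s x‖ ^ 2 * Torus.timeDerivWithin (Ico 0 T) θ s x / (2 * θ s x ^ 2)) * V.1 +
          (inner ℝ (Torus.timeDerivWithin (Ico 0 T) u s x) V.2.1 / θ s x -
            Torus.timeDerivWithin (Ico 0 T) θ s x * inner ℝ (u s x) V.2.1 / θ s x ^ 2) +
          Torus.timeDerivWithin (Ico 0 T) θ s x * V.2.2 / θ s x ^ 2 ∧
      ∀ j : Fin 3,
        Torus.partialDeriv j
            (fun y => fderiv ℝ (hsEntropy σ) (stateOf (ρ s y) (u s y) (θ s y))) x V =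
          ((1 + 2 * (ρ s x * σ ^ 3) * deriv F (ρ s x * σ ^ 3) +
                (ρ s x * σ ^ 3) ^ 2 * deriv (deriv F) (ρ s x * σ ^ 3)) *
                Torus.partialDeriv j (ρ s) x / ρ s x -
              3 / 2 * Torus.partialDeriv j (θ s) x / θ s x -
              inner ℝ (u s x) (Torus.partialDeriv j (u s) x) / θ s x +
              ‖u s x‖ ^ 2 * Torus.partialDeriv j (θ s) x / (2 * θ s x ^ 2)) * V.1 +
            (inner ℝ (Torus.partialDeriv j (u s) x) V.2.1 / θ s x -
              Torus.partialDeriv j (θ s) x * inner ℝ (u s x) V.2.1 / θ s x ^ 2) +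
            Torus.partialDeriv j (θ s) x * V.2.2 / θ s x ^ 2 :=
  fun _ _ hFa hF _ _ hσ hη _ _ _ _ hE hpack =>
    ⟨isSmoothSpaceTimeOn_Lambda hFa hF hσ hE hη hpack, fun _ hs x V =>
      ⟨Lambda_apply_eq hFa hF hσ hE hη hpack hs x V,
        timeDerivWithin_Lambda_apply hFa hF hσ hE hη hpack hs x V, fun j =>
          partialDeriv_Lambda_apply hFa hF hσ hE hη hpack hs x j V⟩⟩

end Barycentric

end Summit.AtomisticToContinuum.HydrodynamicLimit.Theorems.MacroClosureLine

end
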